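import Literature.Computability.Complexity.SymbolPrograms
import HarnessLib

/-!
# Register routines for structured stack programs: equality, finite-state passes, membership scans

Family `fine-grained` (trunk T-CPLX-FINE); toolkit for the machine half of Impagliazzo–Paturi's
Lemma 2 (`ForcedVariableRenaming.lean`: the *renaming machine* has to compute
`IPRename.reduceList` literally, within `2^{εn} · poly(L)` steps). The machine is written as a
structured stack program (`Literature.Computability.Complexity.ACom`, `SymbolPrograms.lean`: exact costs, compiled to
Mathlib's `Turing.FinTM2` by `ACom.exists_computesInTime`). This file provides its generic
routines, each verified once on a small *local register bank* (an inductive type of a few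
registers, with a store constructor and `simp` lemmas for components and updates) and
transported into any register file along an injective map by `ACom.Runs.map`
(`graft_prSt`, `graft_eqSt`, `runs_fstPass_map`, `runs_eqW_map`):

* flags and unary counters over an arbitrary alphabet (`flagW`, `ticks`, `setFlagG`, `orNegG`);
* `eqW` / `runs_eqW` — equality of the contents of two registers (bank `EqR`: the probe is
  restored, the stream consumed, the answer is a normalised flag), `12 |u| + 2 |v| + 12` steps;
* `PassSpec` / `fstPass` / `runs_fstPass` — **finite-state passes**: a transducer with states
  encoded as symbols of a mode register streams a source register onto two accumulators
  (`frun` is its functional semantics); every symbol-by-symbol transformation of one word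
  (splitting at a delimiter, filtering by a predicate, counting a leading block) is an instance
  verified by reasoning on the transducer only, `(E + 6) |w| + 1` steps;
* `memberScan` / `runs_memberScan` — membership of a probe word among the terminated entries of
  a register (bank `MR`), `(12 |probe| + 31) |w| + 1` steps.

## References

* T. Nipkow, G. Klein, *Concrete Semantics with Isabelle/HOL*, Springer 2014, Ch. 7 (big-step
  reasoning; loop invariants), as in `SymbolPrograms.lean`.
* R. Impagliazzo, R. Paturi, *On the complexity of k-SAT*, JCSS 62 (2001), Lemma 2 (the
  reduction whose machine these routines serve).
-/

namespace Literature.Computability.FineGrained.IPRenameM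

open Complexity Complexity.ACom

variable {Γ : Type} [DecidableEq Γ]

/-! ### Flags and unary counters over an arbitrary alphabet -/

/-- A flag word: `[tk]` for true, `[]` for false. [folklore] -/
def flagW (tk : Γ) (p : Prop) [Decidable p] : List Γ := if p then [tk] else []

omit [DecidableEq Γ] in
/-- The true flag. [folklore] -/
@[simp] theorem flagW_true (tk : Γ) {p : Prop} [Decidable p] (h : p) : flagW tk p = [tk] := if_pos h

omit [DecidableEq Γ] in
/-- The false flag. [folklore] -/
@[simp] theorem flagW_false (tk : Γ) {p : Prop} [Decidable p] (h : ¬ p) : flagW tk p = [] := if_neg h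

omit [DecidableEq Γ] in
/-- Flags of equivalent propositions agree (whatever the decidability instances). [folklore] -/
theorem flagW_congr (tk : Γ) {p q : Prop} [Decidable p] [Decidable q] (h : p ↔ q) :
    flagW tk p = flagW tk q := by
  unfold flagW
  by_cases hq : q
  · rw [if_pos hq, if_pos (h.2 hq)]
  · rw [if_neg hq, if_neg (fun hp => hq (h.1 hp))]

omit [DecidableEq Γ] in
/-- Length of a flag word. [folklore] -/
theorem length_flagW_le (tk : Γ) (p : Prop) [Decidable p] : (flagW tk p).length ≤ 1 := by
  unfold flagW; split <;> simp

/-- A unary counter word `tk^n`. [folklore] -/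
def ticks (tk : Γ) (n : ℕ) : List Γ := List.replicate n tk

omit [DecidableEq Γ] in
/-- Length of a unary counter. [folklore] -/
@[simp] theorem length_ticks (tk : Γ) (n : ℕ) : (ticks tk n).length = n := List.length_replicate

omit [DecidableEq Γ] in
/-- Zero. [folklore] -/
@[simp] theorem ticks_zero (tk : Γ) : ticks tk 0 = [] := rfl

omit [DecidableEq Γ] in
/-- Successor. [folklore] -/
theorem ticks_succ (tk : Γ) (n : ℕ) : ticks tk (n + 1) = tk :: ticks tk n := rfl

/-! ### Equality of two register contents -/

/-- The local registers of the equality routine: the probe `x` (preserved), the stream `y`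
(consumed), the save register `x2` and the flag `ne`. [folklore] -/
inductive EqR where
  | x | y | x2 | ne
  deriving DecidableEq, Fintype

/-- Body of the comparison loop: save the symbol of `x`, pop `y`, raise the flag on a mismatch
(keeping it normalised). [folklore] -/
def eqBody (tk : Γ) (a : Γ) : ACom Γ EqR :=
  push EqR.x2 a ;;
  pop EqR.y fun o => if o = some a then skip else (clear EqR.ne ;; push EqR.ne tk)

/-- `eqW tk`: compare the words in `x` and `y` (same orientation); afterwards `x` is restored,
`y` and `x2` are empty and `ne` holds the flag "the words differ". Requires `x2 = ne = []`.
[folklore] -/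
def eqW (tk : Γ) : ACom Γ EqR :=
  loop EqR.x (eqBody tk) ;;
  pop EqR.y (fun o => match o with
    | some _ => clear EqR.ne ;; push EqR.ne tk ;; clear EqR.y
    | none => skip) ;;
  pour EqR.x2 EqR.x

/-- The store of the equality routine with given register contents. [folklore] -/
def eqSt (x y x2 ne : List Γ) : AStore Γ EqR
  | EqR.x => x
  | EqR.y => y
  | EqR.x2 => x2
  | EqR.ne => ne

omit [DecidableEq Γ] in
/-- Components of `eqSt`. [folklore] -/
@[simp] theorem eqSt_x (x y x2 ne : List Γ) : eqSt x y x2 ne EqR.x = x := rfl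
omit [DecidableEq Γ] in
/-- Components of `eqSt`. [folklore] -/
@[simp] theorem eqSt_y (x y x2 ne : List Γ) : eqSt x y x2 ne EqR.y = y := rfl
omit [DecidableEq Γ] in
/-- Components of `eqSt`. [folklore] -/
@[simp] theorem eqSt_x2 (x y x2 ne : List Γ) : eqSt x y x2 ne EqR.x2 = x2 := rfl
omit [DecidableEq Γ] in
/-- Components of `eqSt`. [folklore] -/
@[simp] theorem eqSt_ne (x y x2 ne : List Γ) : eqSt x y x2 ne EqR.ne = ne := rfl

omit [DecidableEq Γ] in
/-- Updating a component of `eqSt`. [folklore] -/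
@[simp] theorem update_eqSt_x (x y x2 ne w : List Γ) :
    Function.update (eqSt x y x2 ne) EqR.x w = eqSt w y x2 ne := by
  funext r; cases r <;> rfl
omit [DecidableEq Γ] in
/-- Updating a component of `eqSt`. [folklore] -/
@[simp] theorem update_eqSt_y (x y x2 ne w : List Γ) :
    Function.update (eqSt x y x2 ne) EqR.y w = eqSt x w x2 ne := by
  funext r; cases r <;> rfl
omit [DecidableEq Γ] in
/-- Updating a component of `eqSt`. [folklore] -/
@[simp] theorem update_eqSt_x2 (x y x2 ne w : List Γ) :
    Function.update (eqSt x y x2 ne) EqR.x2 w = eqSt x y w ne := by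
  funext r; cases r <;> rfl
omit [DecidableEq Γ] in
/-- Updating a component of `eqSt`. [folklore] -/
@[simp] theorem update_eqSt_ne (x y x2 ne w : List Γ) :
    Function.update (eqSt x y x2 ne) EqR.ne w = eqSt x y x2 w := by
  funext r; cases r <;> rfl

omit [DecidableEq Γ] in
/-- Every store of the bank is an `eqSt`. [folklore] -/
theorem eqSt_eta (R : AStore Γ EqR) : R = eqSt (R EqR.x) (R EqR.y) (R EqR.x2) (R EqR.ne) := by
  funext r; cases r <;> rfl

omit [DecidableEq Γ] in
/-- `eqSt` is injective. [folklore] -/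
@[simp] theorem eqSt_inj {x y x2 ne x' y' x2' ne' : List Γ} :
    eqSt x y x2 ne = eqSt x' y' x2' ne' ↔ x = x' ∧ y = y' ∧ x2 = x2' ∧ ne = ne' :=
  ⟨fun h => ⟨congrFun h EqR.x, congrFun h EqR.y, congrFun h EqR.x2, congrFun h EqR.ne⟩,
    fun ⟨h1, h2, h3, h4⟩ => by rw [h1, h2, h3, h4]⟩

omit [DecidableEq Γ] in
/-- Raising the normalised flag: `clear ne ;; push ne tk`. [folklore] -/
theorem runs_raise (tk : Γ) (x y x2 ne : List Γ) (h : ne.length ≤ 1) :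
    Runs (clear EqR.ne ;; push EqR.ne tk) (eqSt x y x2 ne) (eqSt x y x2 [tk]) 4 := by
  have h1 := runs_clear EqR.ne (eqSt x y x2 ne)
  have h2 := Runs.push EqR.ne tk (Function.update (eqSt x y x2 ne) EqR.ne [])
  simp only [update_eqSt_ne, eqSt_ne] at h1 h2
  exact (h1.seq h2).mono (by omega)

/-- **Specification of `eqW`.** [folklore] -/
theorem runs_eqW (tk : Γ) (u v : List Γ) :
    Runs (eqW tk) (eqSt u v [] []) (eqSt u [] [] (flagW tk (u ≠ v)))
      (12 * u.length + 2 * v.length + 12) := by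
  classical
  -- the store during the comparison loop, after consuming `done` (most recent first)
  set S : List Γ → List Γ → AStore Γ EqR := fun done rest =>
    eqSt rest (v.drop done.length) done (flagW tk (done.reverse ≠ v.take done.length)) with hS
  have hS0 : S [] u = eqSt u v [] [] := by simp [hS]
  have hloop := runs_loop_inv (k := EqR.x) (f := eqBody tk) S (fun _ _ => True) 7
    (fun done rest _ => by simp [hS])
    (fun done a rest _ => ⟨trivial, by
      unfold eqBody
      have hfl : (flagW tk (done.reverse ≠ v.take done.length)).length ≤ 1 := length_flagW_le _ _
      have h1 : Runs (push EqR.x2 a) (Function.update (S done (a :: rest)) EqR.x rest)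
          (eqSt rest (v.drop done.length) (a :: done)
            (flagW tk (done.reverse ≠ v.take done.length))) 1 :=
        Runs.push' (by simp [hS])
      cases hd : v.drop done.length with
      | nil =>
        have hvlen : v.length ≤ done.length := by
          have := congrArg List.length hd; simp at this; omega
        have hne : ¬ (done.reverse ++ [a] = v.take (done.length + 1)) := by
          intro e
          have := congrArg List.length e
          simp only [List.length_append, List.length_reverse, List.length_cons,
            List.length_nil, List.length_take] at this
          omega
        have h2 := (runs_raise tk rest [] (a :: done) _ hfl).of_eq (R' := S (a :: done) rest)
          (by simp [hS, hne, List.drop_eq_nil_of_le (by omega : v.length ≤ done.length + 1)])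
          le_rfl
        have h3 := Runs.pop_nil (k := EqR.y) (f := fun o => if o = some a then skip else
          (clear EqR.ne ;; push EqR.ne tk)) (R := eqSt rest [] (a :: done)
            (flagW tk (done.reverse ≠ v.take done.length))) rfl
          (by rw [if_neg (by simp)]; exact h2)
        rw [hd] at h1
        exact (h1.seq h3).mono (by omega)
      | cons b w =>
        have hb : v[done.length]? = some b := by rw [← List.head?_drop, hd]; rfl
        have hw : v.drop (done.length + 1) = w := by rw [← List.tail_drop, hd]; rfl
        have hlt : done.length < v.length := by
          by_contra hge; rw [List.drop_eq_nil_of_le (not_lt.1 hge)] at hd; cases hd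
        have htake : v.take (done.length + 1) = v.take done.length ++ [b] := by
          rw [List.take_add_one, hb]; rfl
        rw [hd] at h1
        by_cases hba : b = a
        · subst hba
          have hiff : (¬ (done.reverse ++ [b] = v.take (done.length + 1))) ↔
              (done.reverse ≠ v.take done.length) := by
            rw [htake, Ne, not_iff_not]
            constructor
            · intro e; exact (List.append_inj' e rfl).1
            · intro e; rw [e]
          have hfleq : flagW tk (¬ (done.reverse ++ [b] = v.take (done.length + 1))) =
              flagW tk (done.reverse ≠ v.take done.length) := by
            by_cases hp : done.reverse ≠ v.take done.length
            · rw [flagW_true _ hp, flagW_true _ (hiff.2 hp)]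
            · rw [flagW_false _ hp, flagW_false _ (fun h => hp (hiff.1 h))]
          have h2 : Runs skip (Function.update (eqSt rest (b :: w) (b :: done)
              (flagW tk (done.reverse ≠ v.take done.length))) EqR.y w) (S (b :: done) rest) 0 :=
            (Runs.skip _).of_eq (by simp [hS, hw, hfleq]) le_rfl
          have h3 := Runs.pop_cons (k := EqR.y) (f := fun o => if o = some b then skip else
            (clear EqR.ne ;; push EqR.ne tk)) (R := eqSt rest (b :: w) (b :: done)
              (flagW tk (done.reverse ≠ v.take done.length))) (a := b) (w := w) rfl
            (by rw [if_pos rfl]; exact h2)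
          exact (h1.seq h3).mono (by omega)
        · have hne : ¬ (done.reverse ++ [a] = v.take (done.length + 1)) := by
            rw [htake]
            intro e
            have := (List.append_inj' e rfl).2
            simp only [List.cons.injEq, and_true] at this
            exact hba this.symm
          have h2 := (runs_raise tk rest w (a :: done) _ hfl).of_eq (R' := S (a :: done) rest)
            (by simp [hS, hne, hw]) le_rfl
          have h3 := Runs.pop_cons (k := EqR.y) (f := fun o => if o = some a then skip else
            (clear EqR.ne ;; push EqR.ne tk)) (R := eqSt rest (b :: w) (a :: done)
              (flagW tk (done.reverse ≠ v.take done.length))) (a := b) (w := w) rfl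
            (by rw [if_neg (by simpa using hba)]; simpa using h2)
          exact (h1.seq h3).mono (by omega)⟩)
    u [] trivial
  rw [hS0] at hloop
  simp only [List.append_nil] at hloop
  -- the length check on `y`
  have hSu : S u.reverse [] = eqSt [] (v.drop u.length) u.reverse (flagW tk (u ≠ v.take u.length)) := by
    simp [hS]
  rw [hSu] at hloop
  set T2 : AStore Γ EqR := eqSt [] [] u.reverse (flagW tk (u ≠ v)) with hT2
  have hstep2 : Runs (pop EqR.y (fun o => match o with
      | some _ => clear EqR.ne ;; push EqR.ne tk ;; clear EqR.y
      | none => skip)) (eqSt [] (v.drop u.length) u.reverse (flagW tk (u ≠ v.take u.length)))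
      T2 (2 * v.length + 7) := by
    have hfl : (flagW tk (u ≠ v.take u.length)).length ≤ 1 := length_flagW_le _ _
    cases hd : v.drop u.length with
    | nil =>
      have hle : v.length ≤ u.length := by
        have := congrArg List.length hd; simp at this; omega
      have h2 : Runs skip (eqSt [] [] u.reverse (flagW tk (u ≠ v.take u.length))) T2 0 := by
        refine (Runs.skip _).of_eq ?_ le_rfl
        rw [hT2, List.take_of_length_le hle]
      exact (Runs.pop_nil (k := EqR.y) rfl h2).mono (by omega)
    | cons b w =>
      have hlt : u.length < v.length := by
        by_contra h
        rw [List.drop_eq_nil_of_le (Nat.le_of_not_lt h)] at hd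
        cases hd
      have hwlen : w.length ≤ v.length := by
        have := congrArg List.length hd
        simp only [List.length_drop, List.length_cons] at this
        omega
      have huv : u ≠ v := fun e => by rw [e] at hlt; exact lt_irrefl _ hlt
      have hc := runs_clear EqR.ne (eqSt [] w u.reverse (flagW tk (u ≠ v.take u.length)))
      simp only [update_eqSt_ne, eqSt_ne] at hc
      have hp := Runs.push EqR.ne tk (eqSt [] w u.reverse [])
      simp only [update_eqSt_ne, eqSt_ne] at hp
      have hy := runs_clear EqR.y (eqSt [] w u.reverse [tk])
      simp only [update_eqSt_y, eqSt_y] at hy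
      have h23 := (hc.seq (hp.seq hy)).of_eq (R' := T2) (B := 2 * v.length + 5)
        (by rw [hT2, flagW_true _ huv]) (by omega)
      exact (Runs.pop_cons (k := EqR.y) (R := eqSt [] (b :: w) u.reverse (flagW tk (u ≠ v.take u.length)))
        (a := b) (w := w) rfl (by simpa using h23)).mono (by omega)
  have hstep3 := runs_pour (a := EqR.x2) (b := EqR.x) (by decide) T2
  rw [hT2] at hstep3
  simp only [eqSt_x2, eqSt_x, update_eqSt_x2, update_eqSt_x, List.reverse_reverse,
    List.append_nil, List.length_reverse] at hstep3
  exact (hloop.seq (hstep2.seq hstep3)).mono (by omega)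

end Literature.Computability.FineGrained.IPRenameM

namespace Literature.Computability.FineGrained.IPRenameM

open Complexity Complexity.ACom

variable {Γ : Type} [DecidableEq Γ]

/-! ### Finite-state passes over a register

A *pass* streams the content of a source register through a finite-state transducer: the
current state is held, encoded as one symbol, in a mode register, and the output symbols are
pushed onto two accumulators (a main one and a side one, e.g. for an extracted field; each
holds its output reversed). Every routine of the renaming machine that transforms or splits one
word symbol by symbol (binary increment and decrement, field extraction, marking, splitting at
a delimiter) is an instance, verified by reasoning on the transducer only. -/

/-- A finite-state pass: transition-and-output function on states `σ` and symbols `Γ` (new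
state, main output, side output, both in reading order), with an encoding of the states as
symbols and a partial decoding. [folklore] -/
structure PassSpec (Γ σ : Type) where
  /-- one step: new state, main output word, side output word -/
  step : σ → Γ → σ × List Γ × List Γ
  /-- states as symbols -/
  enc : σ → Γ
  /-- symbols as states -/
  dec : Γ → Option σ
  /-- decoding inverts encoding -/
  dec_enc : ∀ s, dec (enc s) = some s

/-- The registers of a pass: source, mode, main and side accumulators. [folklore] -/
inductive PR where
  | src | mode | acc | side
  deriving DecidableEq, Fintype

/-- The store of a pass. [folklore] -/
def prSt (src mode acc side : List Γ) : AStore Γ PR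
  | PR.src => src
  | PR.mode => mode
  | PR.acc => acc
  | PR.side => side

omit [DecidableEq Γ] in
/-- Components of `prSt`. [folklore] -/
@[simp] theorem prSt_src (s m a b : List Γ) : prSt s m a b PR.src = s := rfl
omit [DecidableEq Γ] in
/-- Components of `prSt`. [folklore] -/
@[simp] theorem prSt_mode (s m a b : List Γ) : prSt s m a b PR.mode = m := rfl
omit [DecidableEq Γ] in
/-- Components of `prSt`. [folklore] -/
@[simp] theorem prSt_acc (s m a b : List Γ) : prSt s m a b PR.acc = a := rfl
omit [DecidableEq Γ] in
/-- Components of `prSt`. [folklore] -/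
@[simp] theorem prSt_side (s m a b : List Γ) : prSt s m a b PR.side = b := rfl
omit [DecidableEq Γ] in
/-- Updating a component of `prSt`. [folklore] -/
@[simp] theorem update_prSt_src (s m a b w : List Γ) :
    Function.update (prSt s m a b) PR.src w = prSt w m a b := by funext r; cases r <;> rfl
omit [DecidableEq Γ] in
/-- Updating a component of `prSt`. [folklore] -/
@[simp] theorem update_prSt_mode (s m a b w : List Γ) :
    Function.update (prSt s m a b) PR.mode w = prSt s w a b := by funext r; cases r <;> rfl
omit [DecidableEq Γ] in
/-- Updating a component of `prSt`. [folklore] -/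
@[simp] theorem update_prSt_acc (s m a b w : List Γ) :
    Function.update (prSt s m a b) PR.acc w = prSt s m w b := by funext r; cases r <;> rfl
omit [DecidableEq Γ] in
/-- Updating a component of `prSt`. [folklore] -/
@[simp] theorem update_prSt_side (s m a b w : List Γ) :
    Function.update (prSt s m a b) PR.side w = prSt s m a w := by funext r; cases r <;> rfl
omit [DecidableEq Γ] in
/-- `prSt` is injective. [folklore] -/
@[simp] theorem prSt_inj {s m a b s' m' a' b' : List Γ} :
    prSt s m a b = prSt s' m' a' b' ↔ s = s' ∧ m = m' ∧ a = a' ∧ b = b' :=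
  ⟨fun h => ⟨congrFun h PR.src, congrFun h PR.mode, congrFun h PR.acc, congrFun h PR.side⟩,
    fun ⟨h1, h2, h3, h4⟩ => by rw [h1, h2, h3, h4]⟩
omit [DecidableEq Γ] in
/-- Every store of the bank is a `prSt`. [folklore] -/
theorem prSt_eta (R : AStore Γ PR) : R = prSt (R PR.src) (R PR.mode) (R PR.acc) (R PR.side) := by
  funext r; cases r <;> rfl

variable {σ : Type}

/-- The body of a pass: read the state off the mode register, push the outputs, write the new
state. (An undecodable or missing mode symbol does nothing; this never happens in a run from a
well-formed store.) [folklore] -/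
def passBody (P : PassSpec Γ σ) (a : Γ) : ACom Γ PR :=
  pop PR.mode fun o => match o with
    | some m => match P.dec m with
      | some s => pushList PR.acc (P.step s a).2.1 ;; pushList PR.side (P.step s a).2.2 ;;
          push PR.mode (P.enc (P.step s a).1)
      | none => skip
    | none => skip

/-- `fstPass P`: stream the source register through the transducer `P`. [folklore] -/
def fstPass (P : PassSpec Γ σ) : ACom Γ PR := loop PR.src (passBody P)

/-- The functional run of a transducer on a word: final state, main output and side output
(reading order). [folklore] -/
def frun (P : PassSpec Γ σ) : σ → List Γ → σ × List Γ × List Γ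
  | s, [] => (s, [], [])
  | s, a :: w =>
    ((frun P (P.step s a).1 w).1, (P.step s a).2.1 ++ (frun P (P.step s a).1 w).2.1,
      (P.step s a).2.2 ++ (frun P (P.step s a).1 w).2.2)

omit [DecidableEq Γ] in
/-- Running on `w ++ [a]`: one more step after the run on `w`. [folklore] -/
theorem frun_append_singleton (P : PassSpec Γ σ) (s : σ) (w : List Γ) (a : Γ) :
    frun P s (w ++ [a]) =
      ((P.step (frun P s w).1 a).1, (frun P s w).2.1 ++ (P.step (frun P s w).1 a).2.1,
        (frun P s w).2.2 ++ (P.step (frun P s w).1 a).2.2) := by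
  induction w generalizing s with
  | nil => simp [frun]
  | cons b w ih => simp [frun, ih, List.append_assoc]

omit [DecidableEq Γ] in
/-- The outputs of a run with steps emitting at most `E` symbols in total have total length
`≤ E · |w|`. [folklore] -/
theorem length_frun_le (P : PassSpec Γ σ) {E : ℕ}
    (hE : ∀ s a, (P.step s a).2.1.length + (P.step s a).2.2.length ≤ E) :
    ∀ (s : σ) (w : List Γ), (frun P s w).2.1.length + (frun P s w).2.2.length ≤ E * w.length
  | s, [] => by simp [frun]
  | s, a :: w => by
    simp only [frun, List.length_append, List.length_cons, Nat.mul_succ]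
    have := length_frun_le P hE (P.step s a).1 w
    have := hE s a
    omega

omit [DecidableEq Γ] in
/-- **Specification of a pass**: from source `w`, mode `[enc s]` and accumulators `acc`, `side`,
the pass empties the source, ends in mode `[enc s']` and accumulators `out.reverse ++ acc`,
`out'.reverse ++ side`, where `(s', out, out') = frun P s w`, within `(E + 6) · |w| + 1` steps
if every step emits at most `E` symbols. [folklore] -/
theorem runs_fstPass (P : PassSpec Γ σ) {E : ℕ}
    (hE : ∀ s a, (P.step s a).2.1.length + (P.step s a).2.2.length ≤ E)
    (s : σ) (w acc side : List Γ) :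
    Runs (fstPass P) (prSt w [P.enc s] acc side)
      (prSt [] [P.enc (frun P s w).1] ((frun P s w).2.1.reverse ++ acc)
        ((frun P s w).2.2.reverse ++ side)) ((E + 6) * w.length + 1) := by
  classical
  -- the store after consuming `done` (most recent first)
  set S : List Γ → List Γ → AStore Γ PR := fun done rest =>
    prSt rest [P.enc (frun P s done.reverse).1] ((frun P s done.reverse).2.1.reverse ++ acc)
      ((frun P s done.reverse).2.2.reverse ++ side) with hS
  have hS0 : S [] w = prSt w [P.enc s] acc side := by simp [hS, frun]
  have h := runs_loop_inv (k := PR.src) (f := passBody P) S (fun _ _ => True) (E + 4)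
    (fun done rest _ => by simp [hS])
    (fun done a rest _ => ⟨trivial, by
      unfold passBody
      set s₀ := (frun P s done.reverse).1 with hs₀
      set A := (frun P s done.reverse).2.1.reverse ++ acc with hA
      set Bs := (frun P s done.reverse).2.2.reverse ++ side with hB
      have h1 := runs_pushList PR.acc (P.step s₀ a).2.1 (prSt rest [] A Bs)
      simp only [update_prSt_acc, prSt_acc] at h1
      have h2 := runs_pushList PR.side (P.step s₀ a).2.2
        (prSt rest [] ((P.step s₀ a).2.1.reverse ++ A) Bs)
      simp only [update_prSt_side, prSt_side] at h2
      have h3 := Runs.push PR.mode (P.enc (P.step s₀ a).1)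
        (prSt rest [] ((P.step s₀ a).2.1.reverse ++ A) ((P.step s₀ a).2.2.reverse ++ Bs))
      simp only [update_prSt_mode, prSt_mode] at h3
      have h123 := (h1.seq (h2.seq h3)).of_eq (R' := S (a :: done) rest) (B := E + 2) (by
        simp only [hS, hA, hB, List.reverse_cons, frun_append_singleton, ← hs₀,
          List.reverse_append, List.append_assoc]) (by have := hE s₀ a; omega)
      have := Runs.pop_cons (k := PR.mode) (f := fun o => match o with
        | some m => match P.dec m with
          | some s => pushList PR.acc (P.step s a).2.1 ;; pushList PR.side (P.step s a).2.2 ;;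
              push PR.mode (P.enc (P.step s a).1)
          | none => skip
        | none => skip) (R := prSt rest [P.enc s₀] A Bs)
        (a := P.enc s₀) (w := []) rfl (by simpa [P.dec_enc] using h123)
      simpa [hS, ← hs₀, hA, hB] using this⟩)
    w [] trivial
  rw [hS0] at h
  unfold fstPass
  exact h.of_eq (by simp [hS]) (by ring_nf; omega)

omit [DecidableEq Γ] in
/-- **Grafting a pass store**: along an injective register map, the final store of a pass is
an explicit chain of updates of the ambient store. [folklore] -/
theorem graft_prSt {κ : Type} [DecidableEq κ] (S : AStore Γ κ) {f : PR → κ}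
    (hf : Function.Injective f) (a b c d : List Γ) :
    graft S f (prSt a b c d) =
      Function.update (Function.update (Function.update (Function.update S
        (f PR.src) a) (f PR.mode) b) (f PR.acc) c) (f PR.side) d := by
  have : prSt a b c d = Function.update (Function.update (Function.update (Function.update
      (fun i => S (f i)) PR.src a) PR.mode b) PR.acc c) PR.side d := by
    funext r; cases r <;> simp
  rw [this, graft_update_eq S hf, graft_update_eq S hf, graft_update_eq S hf, graft_update_eq S hf,
    graft_self S hf _ (fun _ => rfl)]

omit [DecidableEq Γ] in
/-- **Grafting an equality store.** [folklore] -/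
theorem graft_eqSt {κ : Type} [DecidableEq κ] (S : AStore Γ κ) {f : EqR → κ}
    (hf : Function.Injective f) (a b c d : List Γ) :
    graft S f (eqSt a b c d) =
      Function.update (Function.update (Function.update (Function.update S
        (f EqR.x) a) (f EqR.y) b) (f EqR.x2) c) (f EqR.ne) d := by
  have : eqSt a b c d = Function.update (Function.update (Function.update (Function.update
      (fun i => S (f i)) EqR.x a) EqR.y b) EqR.x2 c) EqR.ne d := by
    funext r; cases r <;> simp
  rw [this, graft_update_eq S hf, graft_update_eq S hf, graft_update_eq S hf, graft_update_eq S hf,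
    graft_self S hf _ (fun _ => rfl)]

omit [DecidableEq Γ] in
/-- **Running a pass inside a larger register file**: if the registers `f src, f mode, f acc,
f side` of `S` hold `w, [enc s], acc, side`, the mapped pass ends in the corresponding update of
`S`. [folklore] -/
theorem runs_fstPass_map {κ : Type} [DecidableEq κ] (P : PassSpec Γ σ) {E : ℕ}
    (hE : ∀ s a, (P.step s a).2.1.length + (P.step s a).2.2.length ≤ E)
    {f : PR → κ} (hf : Function.Injective f) (S : AStore Γ κ) (s : σ) {w acc side : List Γ}
    (h1 : S (f PR.src) = w) (h2 : S (f PR.mode) = [P.enc s]) (h3 : S (f PR.acc) = acc)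
    (h4 : S (f PR.side) = side) :
    Runs ((fstPass P).map f) S
      (Function.update (Function.update (Function.update (Function.update S
        (f PR.src) []) (f PR.mode) [P.enc (frun P s w).1])
        (f PR.acc) ((frun P s w).2.1.reverse ++ acc)) (f PR.side) ((frun P s w).2.2.reverse ++ side))
      ((E + 6) * w.length + 1) := by
  have h := (runs_fstPass P hE s w acc side).map hf S (fun i => by cases i <;> simp [h1, h2, h3, h4])
  rwa [graft_prSt S hf] at h

omit [DecidableEq Γ] in
/-- **Running the equality test inside a larger register file.** [folklore] -/
theorem runs_eqW_map [DecidableEq Γ] {κ : Type} [DecidableEq κ] (tk : Γ) {f : EqR → κ}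
    (hf : Function.Injective f) (S : AStore Γ κ) {u v : List Γ}
    (h1 : S (f EqR.x) = u) (h2 : S (f EqR.y) = v) (h3 : S (f EqR.x2) = []) (h4 : S (f EqR.ne) = []) :
    Runs ((eqW tk).map f) S
      (Function.update (Function.update (Function.update (Function.update S
        (f EqR.x) u) (f EqR.y) []) (f EqR.x2) []) (f EqR.ne) (flagW tk (u ≠ v)))
      (12 * u.length + 2 * v.length + 12) := by
  have h := (runs_eqW tk u v).map hf S (fun i => by cases i <;> simp [h1, h2, h3, h4])
  rwa [graft_eqSt S hf] at h


/-! ### Flags on an arbitrary register file -/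

section Flags

variable {ι : Type} [DecidableEq ι]

/-- Raise a normalised flag register: `clear r ;; push r tk`. [folklore] -/
def setFlagG (tk : Γ) (r : ι) : ACom Γ ι := clear r ;; push r tk

omit [DecidableEq Γ] in
/-- Effect of `setFlagG` on a register holding at most one symbol. [folklore] -/
theorem runs_setFlagG (tk : Γ) (r : ι) (R : AStore Γ ι) (h : (R r).length ≤ 1) :
    Runs (setFlagG tk r) R (Function.update R r [tk]) 4 := by
  unfold setFlagG
  have hc := runs_clear r R
  have hp := Runs.push r tk (Function.update R r [])
  simp only [Function.update_self, Function.update_idem] at hp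
  exact (hc.seq hp).mono (by omega)

/-- OR the negation of the (normalised) flag `ne` into the flag `r`, consuming `ne`. [folklore] -/
def orNegG (tk : Γ) (ne r : ι) : ACom Γ ι :=
  pop ne (fun o => match o with
    | some _ => skip
    | none => setFlagG tk r)

omit [DecidableEq Γ] in
/-- **Specification of `orNegG`.** [folklore] -/
theorem runs_orNegG (tk : Γ) {ne r : ι} (hr : r ≠ ne) (R : AStore Γ ι) (nq p : Prop) [Decidable nq]
    [Decidable p] (hne : R ne = flagW tk nq) (hp : R r = flagW tk p) :
    Runs (orNegG tk ne r) R (Function.update (Function.update R ne []) r (flagW tk (p ∨ ¬ nq))) 6 := by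
  unfold orNegG
  by_cases hq : nq
  · rw [flagW_true _ hq] at hne
    refine (Runs.pop_cons (k := ne) (a := tk) (w := []) hne ((Runs.skip _).of_eq ?_ le_rfl)).mono
      (by omega)
    rw [flagW_congr tk (show (p ∨ ¬ nq) ↔ p by simp [hq]), ← hp,
      show R r = Function.update R ne [] r by rw [Function.update_of_ne hr], Function.update_eq_self]
  · rw [flagW_false _ hq] at hne
    have hlen : (R r).length ≤ 1 := by rw [hp]; exact length_flagW_le _ _
    have hs := runs_setFlagG tk r R hlen
    refine (Runs.pop_nil (k := ne) hne (hs.of_eq ?_ le_rfl)).mono (by omega)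
    rw [flagW_true _ (Or.inr hq)]
    funext reg
    by_cases h1 : reg = r
    · subst h1; simp
    · rw [Function.update_of_ne h1, Function.update_of_ne h1]
      by_cases h2 : reg = ne
      · subst h2; simp [hne]
      · rw [Function.update_of_ne h2]

end Flags

/-! ### A generic membership scan over a register of terminated entries

The entries of the source register are words of *data* symbols (`isData`), each closed by the
terminator `t`; the scan streams the source onto a destination register, collecting the data
symbols of the current entry, and at each terminator compares the collected word with a probe
(by `eqW`) and ORs the answer into a flag. Verified on its own seven-register bank `MR` and
transported by `Runs.map`. -/

/-- The registers of the membership scan. [folklore] -/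
inductive MR where
  | src | dst | coll | probe | x2 | ne | found
  deriving DecidableEq, Fintype

/-- The equality bank inside the membership scan. [folklore] -/
def πM : EqR → MR
  | EqR.x => MR.probe
  | EqR.y => MR.coll
  | EqR.x2 => MR.x2
  | EqR.ne => MR.ne

/-- `πM` is injective. [folklore] -/
theorem πM_injective : Function.Injective πM := by
  intro a b h; cases a <;> cases b <;> simp_all [πM]

/-- Body of the membership scan. [folklore] -/
def memberBody (tk t : Γ) (isData : Γ → Bool) (a : Γ) : ACom Γ MR :=
  if isData a then push MR.dst a ;; push MR.coll a
  else if a = t then push MR.dst t ;; (eqW tk).map πM ;; orNegG tk MR.ne MR.found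
  else push MR.dst a

/-- `memberScan tk t isData`: stream `src` onto `dst`, OR "some entry equals the probe" into
`found`. [folklore] -/
def memberScan (tk t : Γ) (isData : Γ → Bool) : ACom Γ MR := loop MR.src (memberBody tk t isData)

/-- The word of a list of entries, each closed by `t`. [folklore] -/
def wEntries (t : Γ) (es : List (List Γ)) : List Γ := es.flatMap fun e => e ++ [t]

omit [DecidableEq Γ] in
/-- `wEntries` of a cons. [folklore] -/
theorem wEntries_cons (t : Γ) (e : List Γ) (es : List (List Γ)) :
    wEntries t (e :: es) = e ++ t :: wEntries t es := by simp [wEntries]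

omit [DecidableEq Γ] in
/-- `wEntries` of an append. [folklore] -/
theorem wEntries_append (t : Γ) (es es' : List (List Γ)) :
    wEntries t (es ++ es') = wEntries t es ++ wEntries t es' := by simp [wEntries]

/-- The store of the membership scan. [folklore] -/
def mrSt (src dst coll probe x2 ne found : List Γ) : AStore Γ MR
  | MR.src => src
  | MR.dst => dst
  | MR.coll => coll
  | MR.probe => probe
  | MR.x2 => x2
  | MR.ne => ne
  | MR.found => found

omit [DecidableEq Γ] in
/-- Every store of the bank is an `mrSt`. [folklore] -/
theorem mrSt_eta (R : AStore Γ MR) :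
    R = mrSt (R MR.src) (R MR.dst) (R MR.coll) (R MR.probe) (R MR.x2) (R MR.ne) (R MR.found) := by
  funext r; cases r <;> rfl


omit [DecidableEq Γ] in
/-- Components of `mrSt`. [folklore] -/
@[simp] theorem mrSt_src (src dst coll probe x2 ne found : List Γ) : mrSt src dst coll probe x2 ne found MR.src = src := rfl
omit [DecidableEq Γ] in
/-- Components of `mrSt`. [folklore] -/
@[simp] theorem mrSt_dst (src dst coll probe x2 ne found : List Γ) : mrSt src dst coll probe x2 ne found MR.dst = dst := rfl
omit [DecidableEq Γ] in
/-- Components of `mrSt`. [folklore] -/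
@[simp] theorem mrSt_coll (src dst coll probe x2 ne found : List Γ) : mrSt src dst coll probe x2 ne found MR.coll = coll := rfl
omit [DecidableEq Γ] in
/-- Components of `mrSt`. [folklore] -/
@[simp] theorem mrSt_probe (src dst coll probe x2 ne found : List Γ) : mrSt src dst coll probe x2 ne found MR.probe = probe := rfl
omit [DecidableEq Γ] in
/-- Components of `mrSt`. [folklore] -/
@[simp] theorem mrSt_x2 (src dst coll probe x2 ne found : List Γ) : mrSt src dst coll probe x2 ne found MR.x2 = x2 := rfl
omit [DecidableEq Γ] in
/-- Components of `mrSt`. [folklore] -/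
@[simp] theorem mrSt_ne (src dst coll probe x2 ne found : List Γ) : mrSt src dst coll probe x2 ne found MR.ne = ne := rfl
omit [DecidableEq Γ] in
/-- Components of `mrSt`. [folklore] -/
@[simp] theorem mrSt_found (src dst coll probe x2 ne found : List Γ) : mrSt src dst coll probe x2 ne found MR.found = found := rfl
omit [DecidableEq Γ] in
/-- Updating a component of `mrSt`. [folklore] -/
@[simp] theorem update_mrSt_src (src dst coll probe x2 ne found w : List Γ) :
    Function.update (mrSt src dst coll probe x2 ne found) MR.src w = mrSt w dst coll probe x2 ne found := by
  funext r; cases r <;> rfl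
omit [DecidableEq Γ] in
/-- Updating a component of `mrSt`. [folklore] -/
@[simp] theorem update_mrSt_dst (src dst coll probe x2 ne found w : List Γ) :
    Function.update (mrSt src dst coll probe x2 ne found) MR.dst w = mrSt src w coll probe x2 ne found := by
  funext r; cases r <;> rfl
omit [DecidableEq Γ] in
/-- Updating a component of `mrSt`. [folklore] -/
@[simp] theorem update_mrSt_coll (src dst coll probe x2 ne found w : List Γ) :
    Function.update (mrSt src dst coll probe x2 ne found) MR.coll w = mrSt src dst w probe x2 ne found := by
  funext r; cases r <;> rfl
omit [DecidableEq Γ] in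
/-- Updating a component of `mrSt`. [folklore] -/
@[simp] theorem update_mrSt_probe (src dst coll probe x2 ne found w : List Γ) :
    Function.update (mrSt src dst coll probe x2 ne found) MR.probe w = mrSt src dst coll w x2 ne found := by
  funext r; cases r <;> rfl
omit [DecidableEq Γ] in
/-- Updating a component of `mrSt`. [folklore] -/
@[simp] theorem update_mrSt_x2 (src dst coll probe x2 ne found w : List Γ) :
    Function.update (mrSt src dst coll probe x2 ne found) MR.x2 w = mrSt src dst coll probe w ne found := by
  funext r; cases r <;> rfl
omit [DecidableEq Γ] in
/-- Updating a component of `mrSt`. [folklore] -/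
@[simp] theorem update_mrSt_ne (src dst coll probe x2 ne found w : List Γ) :
    Function.update (mrSt src dst coll probe x2 ne found) MR.ne w = mrSt src dst coll probe x2 w found := by
  funext r; cases r <;> rfl
omit [DecidableEq Γ] in
/-- Updating a component of `mrSt`. [folklore] -/
@[simp] theorem update_mrSt_found (src dst coll probe x2 ne found w : List Γ) :
    Function.update (mrSt src dst coll probe x2 ne found) MR.found w = mrSt src dst coll probe x2 ne w := by
  funext r; cases r <;> rfl

omit [DecidableEq Γ] in
/-- `mrSt` is injective. [folklore] -/
@[simp] theorem mrSt_inj {a b c d e f g a' b' c' d' e' f' g' : List Γ} :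
    mrSt a b c d e f g = mrSt a' b' c' d' e' f' g' ↔
      a = a' ∧ b = b' ∧ c = c' ∧ d = d' ∧ e = e' ∧ f = f' ∧ g = g' :=
  ⟨fun h => ⟨congrFun h MR.src, congrFun h MR.dst, congrFun h MR.coll, congrFun h MR.probe,
    congrFun h MR.x2, congrFun h MR.ne, congrFun h MR.found⟩,
    fun ⟨h1, h2, h3, h4, h5, h6, h7⟩ => by rw [h1, h2, h3, h4, h5, h6, h7]⟩

/-- Data symbols of one entry: copied to `dst` and collected in `coll`. [folklore] -/
theorem segRuns_member_data (tk t : Γ) (isData : Γ → Bool) (pr dst0 : List Γ) (p : Prop) [Decidable p] :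
    ∀ (bs : List Γ), (∀ a ∈ bs, isData a = true) → ∀ (rest done yv : List Γ),
      SegRuns MR.src (memberBody tk t isData) bs
        (mrSt (bs ++ rest) (done ++ dst0) yv pr [] [] (flagW tk p))
        (mrSt rest (bs.reverse ++ done ++ dst0) (bs.reverse ++ yv) pr [] [] (flagW tk p)) (6 * bs.length)
  | [], _, rest, done, yv => by simpa using SegRuns.nil MR.src (memberBody tk t isData) _
  | a :: bs, hbs, rest, done, yv => by
    have ha : isData a = true := hbs a (by simp)
    have ih := segRuns_member_data tk t isData pr dst0 p bs (fun a' ha' => hbs a' (by simp [ha'])) rest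
      (a :: done) (a :: yv)
    have hbody : Runs (memberBody tk t isData a)
        (Function.update (mrSt (a :: bs ++ rest) (done ++ dst0) yv pr [] [] (flagW tk p)) MR.src (bs ++ rest))
        (mrSt (bs ++ rest) (a :: done ++ dst0) (a :: yv) pr [] [] (flagW tk p)) 2 := by
      unfold memberBody
      rw [if_pos ha]
      exact ((Runs.push MR.dst a _).seq (Runs.push MR.coll a _)).of_eq (by simp) le_rfl
    refine (SegRuns.cons (k := MR.src) rfl hbody ih).of_eq (by simp) (by simp; omega)

/-- One entry of the membership scan. [folklore] -/
theorem segRuns_member_entry (tk t : Γ) (isData : Γ → Bool) (ht : isData t = false) (pr dst0 : List Γ)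
    (e : List Γ) (he : ∀ a ∈ e, isData a = true) (rest done : List Γ) (p : Prop) [Decidable p] :
    SegRuns MR.src (memberBody tk t isData) (e ++ [t])
      (mrSt (e ++ t :: rest) (done ++ dst0) [] pr [] [] (flagW tk p))
      (mrSt rest (t :: e.reverse ++ done ++ dst0) [] pr [] [] (flagW tk (p ∨ e.reverse = pr)))
      (6 * e.length + 12 * pr.length + 2 * e.length + 23) := by
  classical
  have hbits := segRuns_member_data tk t isData pr dst0 p e he (t :: rest) done []
  simp only [List.append_nil] at hbits
  rw [show e ++ t :: rest = e ++ (t :: rest) from rfl] at hbits ⊢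
  -- the terminator
  have h1 : Runs (push MR.dst t) (mrSt rest (e.reverse ++ done ++ dst0) e.reverse pr [] [] (flagW tk p))
      (mrSt rest (t :: (e.reverse ++ done ++ dst0)) e.reverse pr [] [] (flagW tk p)) 1 :=
    Runs.push' (by simp)
  have h2 := runs_eqW_map tk πM_injective
    (mrSt rest (t :: (e.reverse ++ done ++ dst0)) e.reverse pr [] [] (flagW tk p)) (u := pr) (v := e.reverse)
    (by simp [πM]) (by simp [πM]) (by simp [πM]) (by simp [πM])
  simp only [πM, update_mrSt_probe, update_mrSt_coll, update_mrSt_x2, update_mrSt_ne] at h2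
  have h3 := runs_orNegG tk (ne := MR.ne) (r := MR.found) (by decide)
    (mrSt rest (t :: (e.reverse ++ done ++ dst0)) [] pr [] (flagW tk (pr ≠ e.reverse)) (flagW tk p))
    (pr ≠ e.reverse) p (by simp) (by simp)
  simp only [update_mrSt_ne, update_mrSt_found] at h3
  have hterm : SegRuns MR.src (memberBody tk t isData) [t]
      (mrSt (t :: rest) (e.reverse ++ done ++ dst0) e.reverse pr [] [] (flagW tk p))
      (mrSt rest (t :: e.reverse ++ done ++ dst0) [] pr [] [] (flagW tk (p ∨ e.reverse = pr)))
      (12 * pr.length + 2 * e.length + 23) := by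
    refine SegRuns.single (k := MR.src) rfl ?_
    unfold memberBody
    rw [if_neg (by simp [ht]), if_pos rfl, update_mrSt_src]
    refine (h1.seq (h2.seq h3)).of_eq ?_ (by simp only [List.length_reverse]; omega)
    rw [flagW_congr tk (show (p ∨ ¬ (pr ≠ e.reverse)) ↔ (p ∨ e.reverse = pr) by rw [not_not, eq_comm])]
    simp
  exact (hbits.append hterm).mono (by omega)

/-- All entries of the membership scan. [folklore] -/
theorem segRuns_member_entries (tk t : Γ) (isData : Γ → Bool) (ht : isData t = false) (pr dst0 : List Γ) :
    ∀ (es : List (List Γ)), (∀ e ∈ es, ∀ a ∈ e, isData a = true) →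
      ∀ (rest done : List Γ) (p : Prop) [Decidable p],
      SegRuns MR.src (memberBody tk t isData) (wEntries t es)
        (mrSt (wEntries t es ++ rest) (done ++ dst0) [] pr [] [] (flagW tk p))
        (mrSt rest ((wEntries t es).reverse ++ done ++ dst0) [] pr [] [] (flagW tk (p ∨ ∃ e ∈ es, e.reverse = pr)))
        ((12 * pr.length + 31) * (wEntries t es).length)
  | [], _, rest, done, p, _ => by
    refine (SegRuns.nil MR.src (memberBody tk t isData) _).of_eq ?_ (by simp)
    simp [wEntries, flagW_congr tk (show p ↔ p ∨ ∃ e ∈ ([] : List (List Γ)), e.reverse = pr by simp)]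
  | e :: es, hes, rest, done, p, _ => by
    have h1 := segRuns_member_entry tk t isData ht pr dst0 e (hes e (by simp)) (wEntries t es ++ rest) done p
    have h2 := segRuns_member_entries tk t isData ht pr dst0 es (fun e' he' => hes e' (by simp [he']))
      rest (t :: e.reverse ++ done) (p ∨ e.reverse = pr)
    rw [wEntries_cons]
    rw [show e ++ t :: wEntries t es ++ rest = e ++ t :: (wEntries t es ++ rest) by simp]
    have h12 := h1.append h2
    rw [show e ++ [t] ++ wEntries t es = e ++ t :: wEntries t es by simp] at h12
    refine h12.of_eq ?_ ?_
    · rw [mrSt_inj]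
      refine ⟨rfl, by simp, rfl, rfl, rfl, rfl, flagW_congr tk ?_⟩
      simp [or_assoc]
    · simp only [List.length_append, List.length_cons]
      set C := 12 * pr.length + 31 with hC
      have hb : 8 * e.length ≤ C * e.length := Nat.mul_le_mul_right _ (by omega)
      have he : C * (e.length + ((wEntries t es).length + 1)) = C * e.length + C * (wEntries t es).length + C := by
        ring
      rw [he]; omega

/-- **Specification of the membership scan** on its bank: from `src = wEntries t es`, `dst`,
`coll = x2 = ne = []`, probe `pr`, flag `found = flagW p`, the scan empties `src` onto `dst`
(reversed) and leaves `found = flagW (p ∨ ∃ e ∈ es, e.reverse = pr)`. [folklore] -/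
theorem runs_memberScan (tk t : Γ) (isData : Γ → Bool) (ht : isData t = false) (es : List (List Γ))
    (hes : ∀ e ∈ es, ∀ a ∈ e, isData a = true) (pr dst0 : List Γ) (p : Prop) [Decidable p] :
    Runs (memberScan tk t isData) (mrSt (wEntries t es) dst0 [] pr [] [] (flagW tk p))
      (mrSt [] ((wEntries t es).reverse ++ dst0) [] pr [] [] (flagW tk (p ∨ ∃ e ∈ es, e.reverse = pr)))
      ((12 * pr.length + 31) * (wEntries t es).length + 1) := by
  have h := segRuns_member_entries tk t isData ht pr dst0 es hes [] [] p
  simp only [List.append_nil, List.nil_append] at h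
  exact h.runs_loop_nil rfl

end Literature.Computability.FineGrained.IPRenameM
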